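import Summits.QuantumFields.YangMills.Theorems.TunedSequenceExists.Negative.Freezing
import Summits.QuantumFields.YangMills.Theorems.TunedSequenceExists.Negative.AtZeroFalse

/-!
# `TunedSequenceExists` — β-continuity, exact tuning by the IVT, and the reduction of the weak
# crux body to the finite-volume correlator window lower bound

Crux `Summit.QuantumFields.YangMills.Theses.ParabolicTrajectory.TunedSequenceExists` (item
stmt-QuantumFields-10524; cdisprove gen 2, importable extract of the crux workfile
`Summits/QuantumFields/YangMills/Cruxes/TunedSequenceExists/Disproof.lean`):

* `continuous_laplaceIntegral`, `continuous_integral_wilsonMeasure`,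
  `continuous_latticeConnectedCorr_curvature` — Wilson expectations of continuous observables on a
  fixed torus, in particular the curvature correlator, are continuous in `β` (dominated
  convergence);
* `exists_ge_corr_eq` — freezing (`Negative.Freezing`) + continuity + IVT: if the rescaled
  correlator is `≥ θ₀ > θ > 0` at `β*`, it EQUALS `θ` at some `β ≥ β*`;
* `weak_iff_lowerBound` — the crux body with clause (iii) dropped (shape, `β_k → ∞`, tuning) is
  EQUIVALENT (`M ≥ 2`) to the finite-volume correlator window lower bound
  `∃ θ₀ > 0, ∀ B m₀ L₀, ∃ m ≥ m₀, ∃ L ≥ L₀ M^m, ∃ β ≥ B, θ₀ ≤ (M^m)^8 ⟨P ; τ_{M^m} P⟩_{β, 2L+1}` —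
  the quantitative finite-volume form of `ξ(β) → ∞` (Chatterjee, arXiv:1803.01950, Problem 5.1),
  which is therefore the exact open input of the crux modulo an a-priori bound on `N_t`, `t ≥ 2`
  (crux workfile § ClauseThree). A refutation of that lower bound for ONE `(G, r, M)` refutes the
  crux (`lowerBound_of_tunedSequenceExists`); a proof of it plus the a-priori bound proves it.
-/

noncomputable section

open Filter Topology MeasureTheory
open Literature.MathematicalPhysics.QuantumFieldTheory Literature.MathematicalPhysics.QuantumLattice
open Summit.QuantumFields.YangMills.Theorems.TunedSequenceExists.Negative.Freezing

open Summit.QuantumFields.YangMills.Theorems.TunedSequenceExists.Negative.AtZeroFalse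
  (tendsto_pow_of_shape tendsto_exponent_of_shape eventually_sep_le_L)

namespace Summit.QuantumFields.YangMills.Theorems.TunedSequenceExists.Negative.Glue

section Glue

variable {X : Type*} [TopologicalSpace X] [CompactSpace X] [MeasurableSpace X]
  [OpensMeasurableSpace X]

/-- Laplace-type integrals `β ↦ ∫ g e^{-βS} dμ` are continuous (dominated convergence, locally
uniform domination by `sup|g| · e^{(|β₀|+1) sup|S|}`). -/
theorem continuous_laplaceIntegral (μ : Measure X) [IsFiniteMeasure μ] {S g : X → ℝ}
    (hS : Continuous S) (hg : Continuous g) :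
    Continuous fun β : ℝ => ∫ x, g x * Real.exp (-β * S x) ∂μ := by
  obtain ⟨CS, hCS⟩ := isCompact_univ.exists_bound_of_continuousOn hS.continuousOn
  obtain ⟨Cg, hCg⟩ := isCompact_univ.exists_bound_of_continuousOn hg.continuousOn
  refine continuous_iff_continuousAt.2 fun β₀ => ?_
  have hmeas : ∀ β : ℝ, AEStronglyMeasurable (fun x => g x * Real.exp (-β * S x)) μ := fun β =>
    (hg.mul (Real.continuous_exp.comp (continuous_const.mul hS))).aestronglyMeasurable
  refine continuousAt_of_dominated (bound := fun _ => Cg * Real.exp ((|β₀| + 1) * CS))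
    (Eventually.of_forall hmeas) ?_ (integrable_const _) ?_
  · have hball : ∀ᶠ β in 𝓝 β₀, |β| ≤ |β₀| + 1 := by
      filter_upwards [Metric.ball_mem_nhds β₀ one_pos] with β hβ
      have : |β - β₀| < 1 := by simpa [Real.dist_eq] using hβ
      have h1 := abs_sub_abs_le_abs_sub β β₀
      linarith
    filter_upwards [hball] with β hβ
    refine ae_of_all _ fun x => ?_
    have hgx : |g x| ≤ Cg := by simpa [Real.norm_eq_abs] using hCg x (Set.mem_univ x)
    have hSx : |S x| ≤ CS := by simpa [Real.norm_eq_abs] using hCS x (Set.mem_univ x)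
    have hCg0 : 0 ≤ Cg := (abs_nonneg _).trans hgx
    rw [norm_mul, Real.norm_eq_abs, Real.norm_eq_abs, Real.abs_exp]
    refine mul_le_mul hgx (Real.exp_le_exp.2 ?_) (Real.exp_pos _).le hCg0
    calc -β * S x ≤ |-β * S x| := le_abs_self _
      _ = |β| * |S x| := by rw [abs_mul, abs_neg]
      _ ≤ (|β₀| + 1) * CS := mul_le_mul hβ hSx (abs_nonneg _) (by positivity)
  · exact ae_of_all _ fun x => by fun_prop

omit [CompactSpace X] in
/-- The Laplace partition function is positive (nonempty compact space, open-positive measure). -/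
theorem laplacePartition_pos (μ : Measure X) [IsFiniteMeasure μ] [μ.IsOpenPosMeasure]
    [CompactSpace X] [Nonempty X] {S : X → ℝ} (hS : Continuous S) (β : ℝ) :
    0 < ∫ x, Real.exp (-β * S x) ∂μ := by
  obtain ⟨CS, hCS⟩ := isCompact_univ.exists_bound_of_continuousOn hS.continuousOn
  have hlow : ∀ x, Real.exp (-(|β| * CS)) ≤ Real.exp (-β * S x) := fun x => by
    refine Real.exp_le_exp.2 ?_
    have hSx : |S x| ≤ CS := by simpa [Real.norm_eq_abs] using hCS x (Set.mem_univ x)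
    have : |β * S x| ≤ |β| * CS := by rw [abs_mul]; exact mul_le_mul_of_nonneg_left hSx (abs_nonneg _)
    have := (abs_le.1 this).2
    linarith
  have hU : 0 < μ.real Set.univ :=
    ENNReal.toReal_pos (isOpen_univ.measure_pos μ Set.univ_nonempty).ne' (measure_ne_top μ _)
  calc 0 < Real.exp (-(|β| * CS)) * μ.real Set.univ := mul_pos (Real.exp_pos _) hU
    _ = ∫ _x, Real.exp (-(|β| * CS)) ∂μ := by rw [integral_const, smul_eq_mul, mul_comm]
    _ ≤ ∫ x, Real.exp (-β * S x) ∂μ :=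
        integral_mono (integrable_const _)
          (integrable_of_continuous μ (Real.continuous_exp.comp (continuous_const.mul hS))) hlow

variable {G : Type} [Group G] [TopologicalSpace G] [IsTopologicalGroup G] [CompactSpace G]
  [MeasurableSpace G] [BorelSpace G] {N : ℕ}

/-- **Wilson expectations of continuous observables on a fixed torus are continuous in `β`.** -/
theorem continuous_integral_wilsonMeasure [SecondCountableTopology G] {S : ℕ} [NeZero S]
    (ρ : G →* Matrix (Fin N) (Fin N) ℂ) (hρ : Continuous ρ) {F : GaugeConfig 4 S G → ℝ}
    (hF : Continuous F) : Continuous fun β : ℝ => ∫ U, F U ∂(wilsonMeasure ρ β) := by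
  haveI : (haarProbability G).IsOpenPosMeasure := by unfold haarProbability; infer_instance
  haveI : IsFiniteMeasure (haarProbability G) := by unfold haarProbability; infer_instance
  haveI : Nonempty (GaugeConfig 4 S G) := ⟨fun _ => 1⟩
  simp only [integral_wilsonMeasure_eq_div ρ hρ]
  refine (continuous_laplaceIntegral _ (continuous_wilsonAction ρ hρ) hF).div ?_ fun β =>
    (laplacePartition_pos _ (continuous_wilsonAction ρ hρ) β).ne'
  simpa using continuous_laplaceIntegral (Measure.pi fun _ : Edge 4 S => haarProbability G)
    (continuous_wilsonAction ρ hρ) continuous_const (g := fun _ => (1 : ℝ))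

/-- **The finite-torus curvature correlator is continuous in `β`.** -/
theorem continuous_latticeConnectedCorr_curvature (r : LatticeRep G) (S : ℕ) [NeZero S] (m : ℕ) :
    Continuous fun β : ℝ => latticeConnectedCorr r.ρ β S r.curvature.F r.curvature.F m := by
  haveI : SecondCountableTopology G := secondCountable_of_latticeRep r
  have hlift := continuous_torusLift (G := G) S
  have hA : Continuous fun U : GaugeConfig 4 S G => actionDensity r.ρ (torusLift S U) :=
    (continuous_actionDensity r.continuous).comp hlift
  have hB : Continuous fun U : GaugeConfig 4 S G =>
      actionDensity r.ρ (configShift (-Pi.single 0 (m : ℤ)) (torusLift S U)) :=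
    (continuous_actionDensity r.continuous).comp ((continuous_configShift _).comp hlift)
  have h1 := continuous_integral_wilsonMeasure r.ρ r.continuous (hA.mul hB)
  have h2 := continuous_integral_wilsonMeasure r.ρ r.continuous hA
  have hF : ∀ W, r.curvature.F W = actionDensity r.ρ W := fun W => rfl
  simp only [latticeConnectedCorr, hF]
  exact h1.sub (h2.mul h2)

/-- Exact tuning at one lattice: if the rescaled correlator is `≥ θ₀ > θ > 0` at `β*`, it equals `θ`
at some `β ≥ β*` (continuity + freezing + IVT). -/
theorem exists_ge_corr_eq (r : LatticeRep G) (M m L : ℕ) {θ θ₀ βstar : ℝ} (hθ : 0 < θ)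
    (hθθ₀ : θ < θ₀) (hstar : θ₀ ≤ ((M : ℝ) ^ m) ^ 8 *
      latticeConnectedCorr r.ρ βstar (2 * L + 1) r.curvature.F r.curvature.F (M ^ m)) :
    ∃ β : ℝ, βstar ≤ β ∧ ((M : ℝ) ^ m) ^ 8 *
      latticeConnectedCorr r.ρ β (2 * L + 1) r.curvature.F r.curvature.F (M ^ m) = θ := by
  set f : ℝ → ℝ := fun β => ((M : ℝ) ^ m) ^ 8 *
    latticeConnectedCorr r.ρ β (2 * L + 1) r.curvature.F r.curvature.F (M ^ m) with hf
  have hfc : Continuous f :=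
    continuous_const.mul (continuous_latticeConnectedCorr_curvature r (2 * L + 1) (M ^ m))
  have hlim : Tendsto f atTop (𝓝 0) := by
    have := (latticeConnectedCorr_curvature_tendsto_zero r (2 * L + 1) (M ^ m)).const_mul
      (((M : ℝ) ^ m) ^ 8)
    rwa [mul_zero] at this
  obtain ⟨β₂, hβ₂⟩ := eventually_atTop.1 ((hlim.eventually (gt_mem_nhds hθ)).and
    (eventually_ge_atTop βstar))
  obtain ⟨hlt, hge⟩ := hβ₂ β₂ le_rfl
  have hIVT := intermediate_value_Icc' hge hfc.continuousOn
  obtain ⟨β, hβmem, hβeq⟩ := hIVT ⟨hlt.le, by simpa [hf] using hθθ₀.le.trans hstar⟩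
  exact ⟨β, hβmem.1, hβeq⟩

/-- **Lower bound ⇒ weak crux body, with EXACT tuning** (`N_1(k) = θ` for all `k`). -/
theorem weak_of_lowerBound (r : LatticeRep G) {M : ℕ} (hM : 2 ≤ M)
    (h : ∃ θ₀ : ℝ, 0 < θ₀ ∧ ∀ (B : ℝ) (m₀ L₀ : ℕ), ∃ m : ℕ, m₀ ≤ m ∧ ∃ L : ℕ, L₀ * M ^ m ≤ L ∧
      ∃ β : ℝ, B ≤ β ∧ θ₀ ≤ ((M : ℝ) ^ m) ^ 8 *
        latticeConnectedCorr r.ρ β (2 * L + 1) r.curvature.F r.curvature.F (M ^ m)) :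
    ∃ θ₀ : ℝ, 0 < θ₀ ∧ ∀ θ : ℝ, 0 < θ → θ < θ₀ →
      ∃ (sch : SpeciesScheme (YMSpecies G)) (n : ℕ → ℕ),
        (∀ k, sch.a k = ((M : ℝ) ^ n k)⁻¹) ∧ Tendsto sch.β atTop atTop ∧
        Tendsto (fun k => ((M : ℝ) ^ n k) ^ 8 *
            latticeConnectedCorr r.ρ (sch.β k) (sch.side k) r.curvature.F r.curvature.F
              (M ^ n k)) atTop (𝓝 θ) := by
  obtain ⟨θ₀, hθ₀, h⟩ := h
  refine ⟨θ₀, hθ₀, fun θ hθ hθθ₀ => ?_⟩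
  choose m hm L hL βs hβs hcorr using fun k : ℕ => h (k : ℝ) k k
  choose β hββs hβeq using fun k : ℕ => exists_ge_corr_eq r M (m k) (L k) hθ hθθ₀ (hcorr k)
  have hM1 : (1 : ℝ) < M := by exact_mod_cast hM
  have hm_top : Tendsto m atTop atTop := tendsto_atTop_mono hm tendsto_id
  have hpow_top : Tendsto (fun k => (M : ℝ) ^ m k) atTop atTop :=
    (tendsto_pow_atTop_atTop_of_one_lt hM1).comp hm_top
  let sch : SpeciesScheme (YMSpecies G) :=
    { a := fun k => ((M : ℝ) ^ m k)⁻¹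
      a_pos := fun k => by positivity
      tendsto_a := tendsto_inv_atTop_zero.comp hpow_top
      β := β
      L := L
      tendsto_L := by
        refine tendsto_atTop_mono (fun k => ?_) tendsto_natCast_atTop_atTop
        have hLk : (k : ℝ) * (M : ℝ) ^ m k ≤ L k := by exact_mod_cast hL k
        have hp : (0 : ℝ) < (M : ℝ) ^ m k := by positivity
        show (k : ℝ) ≤ ((M : ℝ) ^ m k)⁻¹ * (L k : ℝ)
        rw [inv_mul_eq_div, le_div_iff₀ hp]
        exact hLk
      c := fun _ _ => 0
      m := fun _ _ => 0 }
  refine ⟨sch, m, fun k => rfl, ?_, ?_⟩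
  · exact tendsto_atTop_mono (fun k => (hβs k).trans (hββs k)) tendsto_natCast_atTop_atTop
  · exact tendsto_const_nhds.congr fun k => (hβeq k).symm

/-- **Weak crux body ⇒ lower bound** (constant `θ₀/4`, where `(0, θ₀)` is the window). -/
theorem lowerBound_of_weak (r : LatticeRep G) {M : ℕ} (hM : 2 ≤ M)
    (h : ∃ θ₀ : ℝ, 0 < θ₀ ∧ ∀ θ : ℝ, 0 < θ → θ < θ₀ →
      ∃ (sch : SpeciesScheme (YMSpecies G)) (n : ℕ → ℕ),
        (∀ k, sch.a k = ((M : ℝ) ^ n k)⁻¹) ∧ Tendsto sch.β atTop atTop ∧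
        Tendsto (fun k => ((M : ℝ) ^ n k) ^ 8 *
            latticeConnectedCorr r.ρ (sch.β k) (sch.side k) r.curvature.F r.curvature.F
              (M ^ n k)) atTop (𝓝 θ)) :
    ∃ θ₀ : ℝ, 0 < θ₀ ∧ ∀ (B : ℝ) (m₀ L₀ : ℕ), ∃ m : ℕ, m₀ ≤ m ∧ ∃ L : ℕ, L₀ * M ^ m ≤ L ∧
      ∃ β : ℝ, B ≤ β ∧ θ₀ ≤ ((M : ℝ) ^ m) ^ 8 *
        latticeConnectedCorr r.ρ β (2 * L + 1) r.curvature.F r.curvature.F (M ^ m) := by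
  obtain ⟨θ₀, hθ₀, h⟩ := h
  obtain ⟨sch, n, hshape, hβ, hlim⟩ := h (θ₀ / 2) (by positivity) (by linarith)
  refine ⟨θ₀ / 4, by positivity, fun B m₀ L₀ => ?_⟩
  have hev1 : ∀ᶠ k in atTop, B ≤ sch.β k := tendsto_atTop.1 hβ B
  have hev2 : ∀ᶠ k in atTop, m₀ ≤ n k :=
    tendsto_atTop.1 (tendsto_exponent_of_shape hM sch hshape) m₀
  have hev3 : ∀ᶠ k in atTop, L₀ * M ^ n k ≤ sch.L k := eventually_sep_le_L sch hshape L₀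
  have hθ4 : θ₀ / 4 < θ₀ / 2 := by linarith
  have hev4 : ∀ᶠ k in atTop, θ₀ / 4 < ((M : ℝ) ^ n k) ^ 8 *
      latticeConnectedCorr r.ρ (sch.β k) (sch.side k) r.curvature.F r.curvature.F (M ^ n k) :=
    hlim.eventually (lt_mem_nhds hθ4)
  obtain ⟨k, hk1, hk2, hk3, hk4⟩ := (hev1.and (hev2.and (hev3.and hev4))).exists
  exact ⟨n k, hk2, sch.L k, hk3, sch.β k, hk1, hk4.le⟩

/-- **The weak crux body IS the finite-volume correlator window lower bound** (`M ≥ 2`). -/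
theorem weak_iff_lowerBound (r : LatticeRep G) {M : ℕ} (hM : 2 ≤ M) :
    (∃ θ₀ : ℝ, 0 < θ₀ ∧ ∀ θ : ℝ, 0 < θ → θ < θ₀ →
      ∃ (sch : SpeciesScheme (YMSpecies G)) (n : ℕ → ℕ),
        (∀ k, sch.a k = ((M : ℝ) ^ n k)⁻¹) ∧ Tendsto sch.β atTop atTop ∧
        Tendsto (fun k => ((M : ℝ) ^ n k) ^ 8 *
            latticeConnectedCorr r.ρ (sch.β k) (sch.side k) r.curvature.F r.curvature.F
              (M ^ n k)) atTop (𝓝 θ)) ↔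
    (∃ θ₀ : ℝ, 0 < θ₀ ∧ ∀ (B : ℝ) (m₀ L₀ : ℕ), ∃ m : ℕ, m₀ ≤ m ∧ ∃ L : ℕ, L₀ * M ^ m ≤ L ∧
      ∃ β : ℝ, B ≤ β ∧ θ₀ ≤ ((M : ℝ) ^ m) ^ 8 *
        latticeConnectedCorr r.ρ β (2 * L + 1) r.curvature.F r.curvature.F (M ^ m)) :=
  ⟨lowerBound_of_weak r hM, weak_of_lowerBound r hM⟩

/-- **The crux implies the lower bound** for every compact simple `G`, faithful unitary `r` and
`M ≥ 2` (clause (iii) is simply dropped). -/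
theorem lowerBound_of_tunedSequenceExists
    (h : Summit.QuantumFields.YangMills.Theses.ParabolicTrajectory.TunedSequenceExists)
    (G : Type) [Group G] [TopologicalSpace G] [IsTopologicalGroup G] [CompactSpace G]
    (hG : IsCompactSimpleLieGroup G) :
    letI : MeasurableSpace G := borel G
    haveI : BorelSpace G := ⟨rfl⟩
    ∀ (r : LatticeRep G) (M : ℕ), 2 ≤ M →
      ∃ θ₀ : ℝ, 0 < θ₀ ∧ ∀ (B : ℝ) (m₀ L₀ : ℕ), ∃ m : ℕ, m₀ ≤ m ∧ ∃ L : ℕ, L₀ * M ^ m ≤ L ∧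
        ∃ β : ℝ, B ≤ β ∧ θ₀ ≤ ((M : ℝ) ^ m) ^ 8 *
          latticeConnectedCorr r.ρ β (2 * L + 1) r.curvature.F r.curvature.F (M ^ m) := by
  letI : MeasurableSpace G := borel G
  haveI : BorelSpace G := ⟨rfl⟩
  intro r M hM
  refine lowerBound_of_weak r hM ?_
  obtain ⟨θ₀, hθ₀, hθ⟩ := h G hG r M hM
  refine ⟨θ₀, hθ₀, fun θ h1 h2 => ?_⟩
  obtain ⟨sch, n, hshape, hβ, -, hlim⟩ := hθ θ h1 h2
  exact ⟨sch, n, hshape, hβ, hlim⟩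

end Glue

end Summit.QuantumFields.YangMills.Theorems.TunedSequenceExists.Negative.Glue

end
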